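/-
Copyright (c) 2026 the pub-hodgecm-mathlib formalisation cell (harness21).  Prover seat hodgecm-mathlib-K2E3-p01 (g0), Track B ∕ K2-LIT
(build stream 29), h413 = `stmt-HodgeConjecture-24833`, line `K2_E3_EllipticInputs`, unit U3, line U3-d (lead K2E3-p03): FILE A of the ‹Ψ-package›
(DEAL SPEC K2/STATUS.md 2026-09-03T22:29:11Z) — part 2, the Cayley scaling on the model `U(σ, J)(K)` over an ultrametric normed field: the ball.  2026-09-03.
-/
import Summits.HodgeConjecture.HodgeConjecture.Theorems.K2E3CayleyScalingAlgebra   -- ★ part 1 (this seat): `inverseWindow_cayley`, conjugation kit, eigenvalue-ball units; brings ★ p855173 (`tendsto_inv_of_tendsto_one`, …), ★ `cayleyGL`, (Q3)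
import Mathlib.Topology.MetricSpace.Ultra.Basic                                      -- `IsUltrametricDist.isOpen_closedBall`
import HarnessLib

/-!
# h413 ∕ Track B «K2-LIT», line `K2_E3_EllipticInputs`, unit U3, line U3-d: THE EIGENVALUE BALL OF THE MODEL `U(σ, J)(K)` IS A CLOPEN Ad-STABLE NEIGHBOURHOOD OF `1`
# ON WHICH THE CAYLEY SCALING `Ψ_s = c ∘ (s·) ∘ c⁻¹` IS DEFINED (‹Ψ-package› FILE A, part 2)

Cell `pub/hodgecm-mathlib`, crux H413 = `stmt-HodgeConjecture-24833`, route of record `HCCMUnconditional`; chair K2-lead (g0), dealer K2E3-plan (g1), line lead of U3-d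
K2E3-p03 (g0).  THEOREMS ONLY (no `def`, no `instance`, no `notation`, no named-fact hypothesis, no `sorry`); imports = ★ + Mathlib + HarnessLib; lane
`--supports stmt-HodgeConjecture-24833 --as helper` (count-neutral).

DESIGN (no definitions).  `K` is an ultrametric normed field, `σ : K →+* K`, `J ∈ M₃(K)`, `M = U(σ, J)(K)` (★ `unitaryGroupOfForm σ J ≤ GL₃(K)`); for `u ∈ M` with matrix `g`
put `X_u = c⁻¹(g) = (g − 1)(g + 1)⁻¹`.  The EIGENVALUE BALL `B` of radius `ρ` enters as a VARIABLE CHARACTERISED BY A HYPOTHESIS, so that the scaling law (SC, FILE C) and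
the sequel can be typed against the same hypothesis and no `def` is shared between files:
`hB : ∀ u, u ∈ B ↔ det(g + 1) ∈ Kˣ ∧ ‖c₂(χ_{X_u})‖ ≤ ρ ∧ ‖c₁(χ_{X_u})‖ ≤ ρ² ∧ ‖c₀(χ_{X_u})‖ ≤ ρ³` (all eigenvalues of `X_u` of absolute value `≤ ρ`; for `ρ < 1`
equivalently all eigenvalues of `g` within `|2|ρ` of `1` — stated on coefficients, no splitting field; every unipotent `u` lies in `B`, `X_u` being nilpotent).

RESULTS ([PlatonovRapinchuk1994] §3.3; [HarishChandra1999] §3.1 Lemma 3.2).  §1 continuity of `A ↦ A⁻¹` at invertible matrices and of `g ↦ c(s•c⁻¹(g))`; §2 for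
`0 < ρ < 1`, `2 ≠ 0`: `isUnit_of_mem_ball` (the side conditions `det(g + 1)`, `det(1 ∓ s•X_u) ∈ Kˣ` for `‖s‖ρ < 1`), `one_mem_ball`, `norm_det_add_one_of_mem_ball`
(`‖det(g + 1)‖ = ‖8‖` on `B`), `isOpen_ball`, `isClosed_ball` (U1: a clopen neighbourhood of `1`), `conj_mem_ball` (U2: Ad-stable), and `exists_cayleyScaling`: a map
`Ψ : M → M` with `mat(Ψ u) = c(s•X_u)`, `mat((Ψ u)⁻¹) = c(−s•X_u)` on `B` (`σ s = s`, `‖s‖ρ < 1`).  Part 3 (`K2E3CayleyScalingMap`) proves (E)(Z)(R)(C)(T)(S) for any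
such `Ψ`; part 4 (`K2E3CayleyScalingPackage`) transports to `Gqs L v` and assembles ‹SC-explicit› → ‹Ψ-package›.

HONEST LABEL.  HC_CM is proved only modulo the 7 printed citations (2 remaining named inputs: hLiu418 = `stmt-HodgeConjecture-24832`, h413 =
`stmt-HodgeConjecture-24833`) until rung 0 closes; this file is a count-neutral helper of the U3-d line.

## References
* [PlatonovRapinchuk1994] V. Platonov, A. Rapinchuk, *Algebraic Groups and Number Theory* (1994), §3.3 (Cayley parametrisation; congruence neighbourhoods).
* [HarishChandra1999AdmissibleDistributions] Harish-Chandra, *Admissible Invariant Distributions on Reductive p-adic Groups*, ULS 16 (1999), §3.1 Lemma 3.2.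
-/

set_option autoImplicit false
-- the mandated namespace repeats the single-problem summit's segment (`HodgeConjecture.HodgeConjecture`), as in every `Theorems/*.lean` of this sub-problem
set_option linter.dupNamespace false

noncomputable section

open Filter Topology Polynomial Set
open scoped Matrix MatrixGroups
open Literature.NumberTheory.Automorphic Literature.NumberTheory.Weil1982.UnitaryFinTopForm Literature.LinearAlgebra.Matrix
open Summit.HodgeConjecture.HodgeConjecture.Cruxes.H413.K2E3CompactCartanRegularRay
open Summit.HodgeConjecture.HodgeConjecture.Cruxes.H413.K2E3CayleyScalingAlgebra

namespace Summit.HodgeConjecture.HodgeConjecture.Cruxes.H413.K2E3CayleyScalingModel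

section Model

variable {K : Type*} [NormedField K] [IsUltrametricDist K] (σ : K →+* K) (J : Matrix (Fin 3) (Fin 3) K) {ρ : ℝ} {s : K}
  {B : Set ↥(unitaryGroupOfForm σ J)}
  (hB : ∀ u : ↥(unitaryGroupOfForm σ J), u ∈ B ↔
    IsUnit (((u : GL (Fin 3) K) : Matrix (Fin 3) (Fin 3) K) + 1).det ∧
    ‖((((u : GL (Fin 3) K) : Matrix (Fin 3) (Fin 3) K) - 1) * (((u : GL (Fin 3) K) : Matrix (Fin 3) (Fin 3) K) + 1)⁻¹).charpoly.coeff 2‖ ≤ ρ ∧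
    ‖((((u : GL (Fin 3) K) : Matrix (Fin 3) (Fin 3) K) - 1) * (((u : GL (Fin 3) K) : Matrix (Fin 3) (Fin 3) K) + 1)⁻¹).charpoly.coeff 1‖ ≤ ρ ^ 2 ∧
    ‖((((u : GL (Fin 3) K) : Matrix (Fin 3) (Fin 3) K) - 1) * (((u : GL (Fin 3) K) : Matrix (Fin 3) (Fin 3) K) + 1)⁻¹).charpoly.coeff 0‖ ≤ ρ ^ 3)

/-! ## §1 Continuity of matrix inversion at an invertible matrix, and of the scaled Cayley chart -/

omit [IsUltrametricDist K] in
/-- **Matrix inversion is continuous at every invertible matrix** (`A⁻¹ = det(A)⁻¹ • adj A`; `det`, `adj` polynomial, `(·)⁻¹` continuous off `0`). [folklore] -/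
theorem continuousAt_matrix_inv {n : Type*} [Fintype n] [DecidableEq n] {A : Matrix n n K} (hA : A.det ≠ 0) :
    ContinuousAt (fun B : Matrix n n K => B⁻¹) A := by
  have hdet : Tendsto (fun B : Matrix n n K => B.det) (𝓝 A) (𝓝 A.det) := (continuous_id.matrix_det).tendsto A
  have hadj : Tendsto (fun B : Matrix n n K => B.adjugate) (𝓝 A) (𝓝 A.adjugate) := (continuous_id.matrix_adjugate).tendsto A
  have h : Tendsto (fun B : Matrix n n K => (B.det)⁻¹ • B.adjugate) (𝓝 A) (𝓝 ((A.det)⁻¹ • A.adjugate)) := (hdet.inv₀ hA).smul hadj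
  have e : ∀ B : Matrix n n K, (B.det)⁻¹ • B.adjugate = B⁻¹ := fun B => by rw [Matrix.inv_def, Ring.inverse_eq_inv]
  have hfun : (fun B : Matrix n n K => B⁻¹) = fun B => (B.det)⁻¹ • B.adjugate := funext fun B => (e B).symm
  rw [ContinuousAt, hfun, ← e A]
  exact h

omit [IsUltrametricDist K] in
/-- The inverse Cayley transform `g ↦ (g − 1)(g + 1)⁻¹` is continuous at every `g` with `g + 1` invertible. [cite: PlatonovRapinchuk1994, §3.3] -/
theorem continuousAt_inverseWindow {g₀ : Matrix (Fin 3) (Fin 3) K} (h : (g₀ + 1).det ≠ 0) :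
    ContinuousAt (fun g : Matrix (Fin 3) (Fin 3) K => (g - 1) * (g + 1)⁻¹) g₀ := by
  have h1 : Tendsto (fun g : Matrix (Fin 3) (Fin 3) K => g - 1) (𝓝 g₀) (𝓝 (g₀ - 1)) := tendsto_id.sub tendsto_const_nhds
  have h2 : Tendsto (fun g : Matrix (Fin 3) (Fin 3) K => g + 1) (𝓝 g₀) (𝓝 (g₀ + 1)) := tendsto_id.add tendsto_const_nhds
  have h3 : Tendsto (fun g : Matrix (Fin 3) (Fin 3) K => (g + 1)⁻¹) (𝓝 g₀) (𝓝 (g₀ + 1)⁻¹) := (continuousAt_matrix_inv h).tendsto.comp h2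
  exact h1.mul h3

omit [IsUltrametricDist K] in
/-- The scaled Cayley transform `g ↦ c(s•(g − 1)(g + 1)⁻¹)` is continuous at every `g` with `g + 1` and `1 − s•X_g` invertible. [cite: PlatonovRapinchuk1994, §3.3] -/
theorem continuousAt_cayley_smul_inverseWindow (s : K) {g₀ : Matrix (Fin 3) (Fin 3) K} (h : (g₀ + 1).det ≠ 0)
    (hm : (1 - s • ((g₀ - 1) * (g₀ + 1)⁻¹)).det ≠ 0) :
    ContinuousAt (fun g : Matrix (Fin 3) (Fin 3) K => cayley (s • ((g - 1) * (g + 1)⁻¹))) g₀ := by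
  have hX : Tendsto (fun g : Matrix (Fin 3) (Fin 3) K => s • ((g - 1) * (g + 1)⁻¹)) (𝓝 g₀) (𝓝 (s • ((g₀ - 1) * (g₀ + 1)⁻¹))) :=
    (continuousAt_inverseWindow h).tendsto.const_smul s
  have hp : Tendsto (fun g : Matrix (Fin 3) (Fin 3) K => 1 + s • ((g - 1) * (g + 1)⁻¹)) (𝓝 g₀) (𝓝 (1 + s • ((g₀ - 1) * (g₀ + 1)⁻¹))) :=
    tendsto_const_nhds.add hX
  have hm' : Tendsto (fun g : Matrix (Fin 3) (Fin 3) K => 1 - s • ((g - 1) * (g + 1)⁻¹)) (𝓝 g₀) (𝓝 (1 - s • ((g₀ - 1) * (g₀ + 1)⁻¹))) :=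
    tendsto_const_nhds.sub hX
  have hmi : Tendsto (fun g : Matrix (Fin 3) (Fin 3) K => (1 - s • ((g - 1) * (g + 1)⁻¹))⁻¹) (𝓝 g₀) (𝓝 (1 - s • ((g₀ - 1) * (g₀ + 1)⁻¹))⁻¹) :=
    (continuousAt_matrix_inv hm).tendsto.comp hm'
  show Tendsto _ _ _
  simp only [cayley_def]
  exact hp.mul hmi

omit [IsUltrametricDist K] in
/-- The matrix of an element of `U(σ, J)(K)` depends continuously on it. [folklore] -/
theorem continuous_coe_mat : Continuous fun u : ↥(unitaryGroupOfForm σ J) => ((u : GL (Fin 3) K) : Matrix (Fin 3) (Fin 3) K) :=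
  Units.continuous_val.comp continuous_subtype_val

/-! ## §2 The eigenvalue ball: side conditions, `1 ∈ B`, open, closed, Ad-stable -/

include hB in
/-- **The side conditions on the ball**: for `u ∈ B` and `‖s‖·ρ < 1`, `det(g + 1)`, `det(1 − s•X_u)` and `det(1 + s•X_u)` are units (the scaled `s•X_u` lies in the `‖s‖ρ`-ball, ★
part 1). [cite: PlatonovRapinchuk1994, §3.3] -/
theorem isUnit_of_mem_ball (hsρ : ‖s‖ * ρ < 1) {u : ↥(unitaryGroupOfForm σ J)} (hu : u ∈ B) :
    IsUnit (((u : GL (Fin 3) K) : Matrix (Fin 3) (Fin 3) K) + 1).det ∧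
    IsUnit (1 - s • ((((u : GL (Fin 3) K) : Matrix (Fin 3) (Fin 3) K) - 1) * (((u : GL (Fin 3) K) : Matrix (Fin 3) (Fin 3) K) + 1)⁻¹)).det ∧
    IsUnit (1 + s • ((((u : GL (Fin 3) K) : Matrix (Fin 3) (Fin 3) K) - 1) * (((u : GL (Fin 3) K) : Matrix (Fin 3) (Fin 3) K) + 1)⁻¹)).det := by
  obtain ⟨hP, h2, h1, h0⟩ := (hB u).1 hu
  obtain ⟨e2, e1, e0⟩ := coeff_ball_smul s h2 h1 h0
  exact ⟨hP, isUnit_det_one_sub_add_of_ball hsρ e2 e1 e0⟩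

include hB in
omit [IsUltrametricDist K] in
/-- `1 ∈ B` (`0 ≤ ρ`, `2 ≠ 0`): `X_1 = 0` has characteristic polynomial `T³`. [cite: PlatonovRapinchuk1994, §3.3] -/
theorem one_mem_ball (hρ : 0 ≤ ρ) (h2 : (2 : K) ≠ 0) : (1 : ↥(unitaryGroupOfForm σ J)) ∈ B := by
  rw [hB]
  have h1 : (((1 : ↥(unitaryGroupOfForm σ J)) : GL (Fin 3) K) : Matrix (Fin 3) (Fin 3) K) = 1 := rfl
  rw [h1, sub_self, Matrix.zero_mul]
  have hc : ∀ k : ℕ, k < 3 → ((0 : Matrix (Fin 3) (Fin 3) K).charpoly.coeff k) = 0 := fun k hk => by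
    rw [Matrix.charpoly_zero, coeff_X_pow, if_neg (by simpa using hk.ne)]
  have h8 : ((1 : Matrix (Fin 3) (Fin 3) K) + 1).det = 2 ^ 3 := by
    rw [show (1 : Matrix (Fin 3) (Fin 3) K) + 1 = (2 : K) • (1 : Matrix (Fin 3) (Fin 3) K) by rw [two_smul], Matrix.det_smul, Matrix.det_one, mul_one,
      Fintype.card_fin]
  refine ⟨?_, ?_, ?_, ?_⟩
  · rw [h8]; exact (isUnit_iff_ne_zero.2 h2).pow 3
  · rw [hc 2 (by norm_num), norm_zero]; exact hρ
  · rw [hc 1 (by norm_num), norm_zero]; exact pow_nonneg hρ 2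
  · rw [hc 0 (by norm_num), norm_zero]; exact pow_nonneg hρ 3

include hB in
/-- **`‖det(g + 1)‖ = ‖8‖` on the ball** (`ρ < 1`): `g = c(X_u)` (★ `cayley_inverseWindow`), so `g + 1 = 2·(1 − X_u)⁻¹` (★ `cayley_add_one`) and `‖det(1 − X_u)‖ = 1`.
[cite: PlatonovRapinchuk1994, §3.3] -/
theorem norm_det_add_one_of_mem_ball (hρ : ρ < 1) (h2 : (2 : K) ≠ 0) {u : ↥(unitaryGroupOfForm σ J)} (hu : u ∈ B) :
    ‖(((u : GL (Fin 3) K) : Matrix (Fin 3) (Fin 3) K) + 1).det‖ = ‖(8 : K)‖ := by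
  obtain ⟨hP, hc2, hc1, hc0⟩ := (hB u).1 hu
  have h2u : IsUnit (2 : K) := isUnit_iff_ne_zero.2 h2
  obtain ⟨hm, hcay⟩ := cayley_inverseWindow h2u hP
  set X₀ := ((((u : GL (Fin 3) K) : Matrix (Fin 3) (Fin 3) K) - 1) * (((u : GL (Fin 3) K) : Matrix (Fin 3) (Fin 3) K) + 1)⁻¹) with hX₀
  have hg1 : ((u : GL (Fin 3) K) : Matrix (Fin 3) (Fin 3) K) + 1 = (2 : K) • (1 - X₀)⁻¹ := by
    conv_lhs => rw [← hcay]
    exact cayley_add_one hm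
  rw [hg1, Matrix.det_smul, Matrix.det_nonsing_inv, Ring.inverse_eq_inv, norm_mul, norm_inv, norm_det_one_sub_eq_one hρ hc2 hc1 hc0, inv_one, mul_one,
    norm_pow, Fintype.card_fin, show (8 : K) = 2 ^ 3 by norm_num, norm_pow]

include hB in
/-- **`B` is OPEN** (`0 < ρ`): `{det(g + 1) ≠ 0}` is open, `X_u` is continuous there, the coefficients are polynomial, and closed balls of an ultrametric field are open.
[cite: PlatonovRapinchuk1994, §3.3] -/
theorem isOpen_ball (hρ : 0 < ρ) : IsOpen B := by
  rw [isOpen_iff_mem_nhds]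
  intro u hu
  obtain ⟨hP, hc2, hc1, hc0⟩ := (hB u).1 hu
  have hP' : (((u : GL (Fin 3) K) : Matrix (Fin 3) (Fin 3) K) + 1).det ≠ 0 := hP.ne_zero
  -- the coefficient maps and the determinant are continuous at `u`
  have hX : Tendsto (fun u' : ↥(unitaryGroupOfForm σ J) =>
      (((u' : GL (Fin 3) K) : Matrix (Fin 3) (Fin 3) K) - 1) * (((u' : GL (Fin 3) K) : Matrix (Fin 3) (Fin 3) K) + 1)⁻¹) (𝓝 u)
      (𝓝 ((((u : GL (Fin 3) K) : Matrix (Fin 3) (Fin 3) K) - 1) * (((u : GL (Fin 3) K) : Matrix (Fin 3) (Fin 3) K) + 1)⁻¹)) :=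
    (continuousAt_inverseWindow hP').tendsto.comp ((continuous_coe_mat σ J).tendsto u)
  have hck : ∀ k : ℕ, Tendsto (fun u' : ↥(unitaryGroupOfForm σ J) =>
      ((((u' : GL (Fin 3) K) : Matrix (Fin 3) (Fin 3) K) - 1) * (((u' : GL (Fin 3) K) : Matrix (Fin 3) (Fin 3) K) + 1)⁻¹).charpoly.coeff k) (𝓝 u)
      (𝓝 (((((u : GL (Fin 3) K) : Matrix (Fin 3) (Fin 3) K) - 1) * (((u : GL (Fin 3) K) : Matrix (Fin 3) (Fin 3) K) + 1)⁻¹).charpoly.coeff k)) :=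
    fun k => ((continuous_charpoly_coeff k).tendsto _).comp hX
  have hdetc : Continuous fun u' : ↥(unitaryGroupOfForm σ J) => (((u' : GL (Fin 3) K) : Matrix (Fin 3) (Fin 3) K) + 1).det :=
    ((continuous_coe_mat σ J).add continuous_const).matrix_det
  -- each of the four conditions holds near `u`
  have e0 : ∀ᶠ u' : ↥(unitaryGroupOfForm σ J) in 𝓝 u, IsUnit (((u' : GL (Fin 3) K) : Matrix (Fin 3) (Fin 3) K) + 1).det :=
    (hdetc.continuousAt.eventually_ne hP').mono fun u' h => isUnit_iff_ne_zero.2 h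
  have eball : ∀ (k : ℕ) (c : ℝ), 0 < c →
      ‖((((u : GL (Fin 3) K) : Matrix (Fin 3) (Fin 3) K) - 1) * (((u : GL (Fin 3) K) : Matrix (Fin 3) (Fin 3) K) + 1)⁻¹).charpoly.coeff k‖ ≤ c →
      ∀ᶠ u' : ↥(unitaryGroupOfForm σ J) in 𝓝 u,
        ‖((((u' : GL (Fin 3) K) : Matrix (Fin 3) (Fin 3) K) - 1) * (((u' : GL (Fin 3) K) : Matrix (Fin 3) (Fin 3) K) + 1)⁻¹).charpoly.coeff k‖ ≤ c := by
    intro k c hc hk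
    have hmem : ∀ᶠ y in 𝓝 (((((u : GL (Fin 3) K) : Matrix (Fin 3) (Fin 3) K) - 1) * (((u : GL (Fin 3) K) : Matrix (Fin 3) (Fin 3) K) + 1)⁻¹).charpoly.coeff k),
        y ∈ Metric.closedBall (0 : K) c :=
      (IsUltrametricDist.isOpen_closedBall (0 : K) hc.ne').mem_nhds (by simpa using hk)
    exact ((hck k).eventually hmem).mono fun u' h => by simpa using h
  filter_upwards [e0, eball 2 ρ hρ hc2, eball 1 (ρ ^ 2) (pow_pos hρ 2) hc1, eball 0 (ρ ^ 3) (pow_pos hρ 3) hc0] with u' h h2' h1' h0'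
  exact (hB u').2 ⟨h, h2', h1', h0'⟩

include hB in
/-- **`B` is CLOSED** (`ρ < 1`, `2 ≠ 0`): `B` lies in the closed set `A = {‖det(g + 1)‖ = ‖8‖}`, on which `X_u` and its coefficients are continuous, and `B` is cut out of `A` by closed
conditions (`ContinuousOn.preimage_isClosed_of_isClosed`). [cite: PlatonovRapinchuk1994, §3.3] -/
theorem isClosed_ball (hρ : ρ < 1) (h2 : (2 : K) ≠ 0) : IsClosed B := by
  have h8 : ‖(8 : K)‖ ≠ 0 := by
    rw [norm_ne_zero_iff, show (8 : K) = 2 ^ 3 by norm_num]; exact pow_ne_zero _ h2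
  set A : Set ↥(unitaryGroupOfForm σ J) := {u | ‖(((u : GL (Fin 3) K) : Matrix (Fin 3) (Fin 3) K) + 1).det‖ = ‖(8 : K)‖} with hA
  have hdetc : Continuous fun u' : ↥(unitaryGroupOfForm σ J) => (((u' : GL (Fin 3) K) : Matrix (Fin 3) (Fin 3) K) + 1).det :=
    ((continuous_coe_mat σ J).add continuous_const).matrix_det
  have hAc : IsClosed A := isClosed_eq (continuous_norm.comp hdetc) continuous_const
  have hXA : ContinuousOn (fun u' : ↥(unitaryGroupOfForm σ J) =>
      (((u' : GL (Fin 3) K) : Matrix (Fin 3) (Fin 3) K) - 1) * (((u' : GL (Fin 3) K) : Matrix (Fin 3) (Fin 3) K) + 1)⁻¹) A := by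
    intro u hu
    have hP' : (((u : GL (Fin 3) K) : Matrix (Fin 3) (Fin 3) K) + 1).det ≠ 0 := by
      rw [← norm_ne_zero_iff]; rw [hA, mem_setOf_eq] at hu; rw [hu]; exact h8
    have ht : Tendsto (fun u' : ↥(unitaryGroupOfForm σ J) =>
        (((u' : GL (Fin 3) K) : Matrix (Fin 3) (Fin 3) K) - 1) * (((u' : GL (Fin 3) K) : Matrix (Fin 3) (Fin 3) K) + 1)⁻¹) (𝓝 u)
        (𝓝 ((((u : GL (Fin 3) K) : Matrix (Fin 3) (Fin 3) K) - 1) * (((u : GL (Fin 3) K) : Matrix (Fin 3) (Fin 3) K) + 1)⁻¹)) :=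
      (continuousAt_inverseWindow hP').tendsto.comp ((continuous_coe_mat σ J).tendsto u)
    exact ht.mono_left nhdsWithin_le_nhds
  have hck : ∀ k : ℕ, ContinuousOn (fun u' : ↥(unitaryGroupOfForm σ J) =>
      ‖((((u' : GL (Fin 3) K) : Matrix (Fin 3) (Fin 3) K) - 1) * (((u' : GL (Fin 3) K) : Matrix (Fin 3) (Fin 3) K) + 1)⁻¹).charpoly.coeff k‖) A :=
    fun k => (continuous_norm.comp (continuous_charpoly_coeff k)).comp_continuousOn hXA
  -- `B = (A ∩ C₂) ∩ ((A ∩ C₁) ∩ (A ∩ C₀))`, each piece closed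
  set f : ℕ → ↥(unitaryGroupOfForm σ J) → ℝ := fun k u' =>
      ‖((((u' : GL (Fin 3) K) : Matrix (Fin 3) (Fin 3) K) - 1) * (((u' : GL (Fin 3) K) : Matrix (Fin 3) (Fin 3) K) + 1)⁻¹).charpoly.coeff k‖ with hf
  have hBeq : B = (A ∩ f 2 ⁻¹' Iic ρ) ∩ ((A ∩ f 1 ⁻¹' Iic (ρ ^ 2)) ∩ (A ∩ f 0 ⁻¹' Iic (ρ ^ 3))) := by
    ext u
    simp only [mem_inter_iff, mem_preimage, mem_Iic, hA, mem_setOf_eq, hf]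
    constructor
    · intro hu
      obtain ⟨_, hc2, hc1, hc0⟩ := (hB u).1 hu
      have hd := norm_det_add_one_of_mem_ball σ J hB hρ h2 hu
      exact ⟨⟨hd, hc2⟩, ⟨hd, hc1⟩, ⟨hd, hc0⟩⟩
    · rintro ⟨⟨hdet, hc2⟩, ⟨-, hc1⟩, ⟨-, hc0⟩⟩
      refine (hB u).2 ⟨isUnit_iff_ne_zero.2 ?_, hc2, hc1, hc0⟩
      rw [← norm_ne_zero_iff, hdet]; exact h8
  rw [hBeq]
  exact ((hck 2).preimage_isClosed_of_isClosed hAc isClosed_Iic).inter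
    (((hck 1).preimage_isClosed_of_isClosed hAc isClosed_Iic).inter ((hck 0).preimage_isClosed_of_isClosed hAc isClosed_Iic))

include hB in
/-- **(U1) `B` is a neighbourhood of `1`** (`0 < ρ`, `2 ≠ 0`). [cite: PlatonovRapinchuk1994, §3.3] -/
theorem ball_mem_nhds_one (hρ : 0 < ρ) (h2 : (2 : K) ≠ 0) : B ∈ 𝓝 (1 : ↥(unitaryGroupOfForm σ J)) :=
  (isOpen_ball σ J hB hρ).mem_nhds (one_mem_ball σ J hB hρ.le h2)

include hB in
omit [IsUltrametricDist K] in
/-- **(U2) `B` is Ad-stable**: `u ∈ B ⇒ x u x⁻¹ ∈ B` (`det` and the characteristic polynomial of `X_{xux⁻¹} = x X_u x⁻¹` are conjugation invariant, ★ `det_conj_add_one`, ★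
`inverseWindow_conj`, Mathlib `Matrix.charpoly_units_conj`). [cite: PlatonovRapinchuk1994, §3.3] -/
theorem conj_mem_ball {u : ↥(unitaryGroupOfForm σ J)} (hu : u ∈ B) (x : ↥(unitaryGroupOfForm σ J)) : x * u * x⁻¹ ∈ B := by
  obtain ⟨hP, hc2, hc1, hc0⟩ := (hB u).1 hu
  have hmat : (((x * u * x⁻¹ : ↥(unitaryGroupOfForm σ J)) : GL (Fin 3) K) : Matrix (Fin 3) (Fin 3) K) =
      ((x : GL (Fin 3) K) : Matrix (Fin 3) (Fin 3) K) * ((u : GL (Fin 3) K) : Matrix (Fin 3) (Fin 3) K) * (((x : GL (Fin 3) K)⁻¹ : GL (Fin 3) K) : Matrix (Fin 3) (Fin 3) K) := by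
    simp only [Subgroup.coe_mul, Subgroup.coe_inv, Units.val_mul]
  rw [hB, hmat, det_conj_add_one, inverseWindow_conj (x : GL (Fin 3) K) hP]
  have hchar : (((x : GL (Fin 3) K) : Matrix (Fin 3) (Fin 3) K) *
      (((((u : GL (Fin 3) K) : Matrix (Fin 3) (Fin 3) K) - 1) * (((u : GL (Fin 3) K) : Matrix (Fin 3) (Fin 3) K) + 1)⁻¹)) *
      (((x : GL (Fin 3) K)⁻¹ : GL (Fin 3) K) : Matrix (Fin 3) (Fin 3) K)).charpoly =
      (((((u : GL (Fin 3) K) : Matrix (Fin 3) (Fin 3) K) - 1) * (((u : GL (Fin 3) K) : Matrix (Fin 3) (Fin 3) K) + 1)⁻¹)).charpoly := by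
    rw [Matrix.coe_units_inv]
    exact Matrix.charpoly_units_conj (x : GL (Fin 3) K) _
  rw [hchar]
  exact ⟨hP, hc2, hc1, hc0⟩

/-! ## §3 The Cayley scaling exists on the ball -/

include hB in
/-- **THE CAYLEY SCALING `Ψ_s` EXISTS ON `B`**: for `σ s = s` and `‖s‖·ρ < 1` there is `Ψ : U(σ, J)(K) → U(σ, J)(K)` whose value at `u ∈ B` is the unitary element with matrix
`c(s•X_u)` and inverse matrix `c(−s•X_u)` (the unit ★ `cayleyGL (s•X_u)`, unitary because `s•X_u` is skew: ★ `transpose_map_inverseWindow_add_eq_zero`, ★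
`skew_smul_of_fixed`, ★ `transpose_map_cayley_mul_mul_cayley`); off `B` the value is `1` (never read). [cite: PlatonovRapinchuk1994, §3.3]
[cite: HarishChandra1999AdmissibleDistributions, §3.1 Lemma 3.2] -/
theorem exists_cayleyScaling (hσs : σ s = s) (hsρ : ‖s‖ * ρ < 1) :
    ∃ Ψ : ↥(unitaryGroupOfForm σ J) → ↥(unitaryGroupOfForm σ J), ∀ u ∈ B,
      (((Ψ u : ↥(unitaryGroupOfForm σ J)) : GL (Fin 3) K) : Matrix (Fin 3) (Fin 3) K) =
          cayley (s • ((((u : GL (Fin 3) K) : Matrix (Fin 3) (Fin 3) K) - 1) * (((u : GL (Fin 3) K) : Matrix (Fin 3) (Fin 3) K) + 1)⁻¹)) ∧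
      ((((Ψ u : ↥(unitaryGroupOfForm σ J)) : GL (Fin 3) K)⁻¹ : GL (Fin 3) K) : Matrix (Fin 3) (Fin 3) K) =
          cayley (-(s • ((((u : GL (Fin 3) K) : Matrix (Fin 3) (Fin 3) K) - 1) * (((u : GL (Fin 3) K) : Matrix (Fin 3) (Fin 3) K) + 1)⁻¹))) := by
  classical
  have hunit : ∀ u ∈ B, ∀ (hm : IsUnit (1 - s • ((((u : GL (Fin 3) K) : Matrix (Fin 3) (Fin 3) K) - 1) * (((u : GL (Fin 3) K) : Matrix (Fin 3) (Fin 3) K) + 1)⁻¹)).det)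
      (hp : IsUnit (1 + s • ((((u : GL (Fin 3) K) : Matrix (Fin 3) (Fin 3) K) - 1) * (((u : GL (Fin 3) K) : Matrix (Fin 3) (Fin 3) K) + 1)⁻¹)).det),
      cayleyGL (s • ((((u : GL (Fin 3) K) : Matrix (Fin 3) (Fin 3) K) - 1) * (((u : GL (Fin 3) K) : Matrix (Fin 3) (Fin 3) K) + 1)⁻¹)) hm hp ∈
        unitaryGroupOfForm σ J := by
    intro u hu hm hp
    obtain ⟨hP, -, -⟩ := isUnit_of_mem_ball σ J hB hsρ hu
    exact mem_unitaryGroupOfForm_iff.2 (transpose_map_cayley_mul_mul_cayley σ hm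
      (skew_smul_of_fixed σ (transpose_map_inverseWindow_add_eq_zero σ (mem_unitaryGroupOfForm_iff.1 u.2) hP) hσs))
  refine ⟨fun u => if h : u ∈ B then
      ⟨cayleyGL (s • ((((u : GL (Fin 3) K) : Matrix (Fin 3) (Fin 3) K) - 1) * (((u : GL (Fin 3) K) : Matrix (Fin 3) (Fin 3) K) + 1)⁻¹))
          (isUnit_of_mem_ball σ J hB hsρ h).2.1 (isUnit_of_mem_ball σ J hB hsρ h).2.2,
        hunit u h _ _⟩ else 1, fun u hu => ?_⟩
  simp only [dif_pos hu]
  exact ⟨rfl, rfl⟩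

end Model

end Summit.HodgeConjecture.HodgeConjecture.Cruxes.H413.K2E3CayleyScalingModel

end
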